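import Literature.MathematicalPhysics.QuantumFieldTheory.Balaban1983to89.Beta.RemainderLimitTorus
import Literature.MathematicalPhysics.QuantumFieldTheory.Balaban1983to89.B12Decay510Holo

/-!
# `Beta.RemainderLimitTorusHolo` — the torus remainder chain with termwise locality in HOLOMORPHIC currency:
# the leaf `han : AnalyticOnNhd ℂ` of `RemainderLimitTorus.PolLeavesTLoc` replaced by `hdiff : DifferentiableOn ℂ`,
# SAME END `|β¹_{k+1}| ≤ ε₁ · K_rem,L`, SAME closed coefficient

Cell pub-balaban, β-function sub-cell, BINDER row D4 (unit `b2b-balaban-beta-an4` gen 49, row D4 OWNER; record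
`HOME/b2b-balaban-beta-an4/D4-CRUX-SOCKETS.md` v1.1 design point M1′, census `BETA/REMAINDER-BETA.md` §10.41).

WHY.  The row-D4 socket (`RemainderDecay190.PolLeavesTFac190` → … → `RemainderLimitTorus.PolLeavesTLoc` →
`RemainderChainTorus.PolLeavesT` → `RemainderChain.PolLeaves`) carries [I] p. 281 (4.4) *"Thus it is defined and
analytic on the space of configurations 𝐀 …"* as the FIELD `han : ∀ n X, AnalyticOnNhd ℂ (EXn n X) (ball 0 α₂)`
(power-series analyticity on a complex Banach ball), while every producer of such one-step functionals in the tree —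
the Kotecký–Preiss logarithm in a Banach parameter (`PolymerPressureAnalytic.differentiableOn_polymerLogZ_param`), the
cluster expansions of `Dimock2011to13.ClusterExpansionAnalytic`, the T⁴ one-step envelope
`T4InputCauchyRateData.StepModel.OutputEnvelope` — delivers `DifferentiableOn ℂ`, and Mathlib has no
`DifferentiableOn → AnalyticOnNhd` on a Banach domain (Osgood/Hartogs absent; `Literature.Analysis.Complex.Osgood`).
`B12Decay510Holo` (p249317) re-derived the ONE place the chain uses (4.4) — the Cauchy bilinear estimate (4.5) — from
`DifferentiableOn` alone.  This module re-threads the `PolLeavesTLoc` pipeline of `RemainderLimitTorus` (the (1.18)-leaf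
from KP, the kernel bound, the wrapping-mass estimate, dominated convergence of the domain sums = (5.1), the (5.10)
decay, the k-UNIFORM END) on the twin structure `PolLeavesTLocH` whose only difference is that field.  Every statement,
constant and proof step is the original's; `qBound_of_differentiableOn` and `decay510_of_differentiable_leaves` replace
`qBound_of_analytic` / `decay510_of_analytic_leaves`.  `PolLeavesTLocH.ofAnalytic` records that the old leaf list IS a
new one (the hypotheses are WEAKER).

WHAT IS PROVED (0 sorry; [folklore] bookkeeping + the printed shapes):
* §1 `PolLeavesTLocH` and the pipeline `h118`, `kernelBound`, `abs_term_le`, `abs_term_le_major`, `bad_mass_le`,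
  `tendsto_bad_mass`, `eventually_good`, **`tendsto_sum`** ((5.1): the T ↗ ℤ^d limit of the domain sums EXISTS and is
  `limKernel a`), `summable`, **`decay510`** ((5.10) for the limit kernel with constant `A_rem · K_Π,L`, δ₁ = `deltaL`).
* The chain `ChainTLocH`, its END `abs_beta1_le : RemainderConst S γ (ε₁ · remCoeffL d M c α₂ B₃)` (SAME coefficient as
  `RemainderLimitTorus.ChainTLoc.abs_beta1_le`), the RULING-(R10) consumers and the `ofAnalytic` embeddings are the
  sibling module `Beta.RemainderLimitTorusHoloChain` (file-size rule).
HONEST FRAMING: a re-threading of the REDUCTION; nothing of Bałaban's asserted; (D4) NOT discharged (instance 0/1);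
NOT BetaPertH, NOT continuum, NOT Clay.  HONEST DEPENDENCY: continuum YM on T⁴ ⇐ BetaPertH ∧ nine spine estimates
(0/9 proved); BetaPertH ⇐ (D1) ∧ (D4) ∧ CAP+tail; G-an2-4 gates asym, D1 and NE2/3/4.
-/

namespace Literature.MathematicalPhysics.QuantumFieldTheory.Balaban1983to89.Beta.RemainderLimitTorusHolo

open Literature.MathematicalPhysics.QuantumFieldTheory.Balaban1983to89
open FlowStep DagBinding FlowStepRuns
open Literature.MathematicalPhysics.QuantumFieldTheory.Balaban1983to89.B13ScaleTransfer (Pt Adj Linked FaceConnected)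
open Literature.MathematicalPhysics.QuantumFieldTheory.Balaban1983to89.B13Resummation (SpRestr Repr213)
open Literature.MathematicalPhysics.QuantumFieldTheory.Balaban1983to89.B12TreeDecay
  (a₀ kappa₀ K₀ K₀_pos sum_exp_vol_le exp_tree_le_exp_vol)
open Literature.MathematicalPhysics.QuantumFieldTheory.Balaban1983to89.TreeLengthTorus
  (TPt TDom proj TAdj TLinked TFaceConnected tFaceConnected_image tsys tcubeSys torusTreeLen torusTreeLen_nonneg tsys_dj
    tcubeSys_vol tvolumeLeaf natLift)
open Literature.MathematicalPhysics.QuantumFieldTheory.Balaban1983to89.TreeLengthTorusGeometry (TorusStep)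
open Literature.MathematicalPhysics.QuantumFieldTheory.Balaban1983to89.TreeLengthCubeSystem
  (Dom cubeSys Cell cubeSys_vol degreeLE)
open Literature.MathematicalPhysics.QuantumFieldTheory.Balaban1983to89.B12Decay510
  (KernelBound kernelBound_of_repr435 weight_sum_le sum_pick_le mixedDeriv delta1)
open Literature.MathematicalPhysics.QuantumFieldTheory.Balaban1983to89.B12Decay510Holo
  (qBound_of_differentiableOn decay510_of_differentiable_leaves)
open Literature.MathematicalPhysics.QuantumFieldTheory.Balaban1983to89.B12Decay510Window (K₁ K₁_nonneg l1_neg)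
open Literature.MathematicalPhysics.QuantumFieldTheory.Balaban1983to89.B12Decay510Lattice
  (cubeOf distCube distCube_nonneg distCube_le_l1_sub nearL nearL_le geomL geomL_distC cubeSumLeafL)
open Literature.MathematicalPhysics.QuantumFieldTheory.Balaban1983to89.B12Decay510Torus
  (pabs pabs_nonneg pabs_add_le vmaVec vmaVec_injective proj_vmaVec pl1 pl1_eq_sum pl1_sub_comm tcubeOf distCT
    distCT_nonneg nearT nearT_mem geomT geomT_distD geomT_distC cubeSumLeafT treeLeafT geomLeafT
    pl1_proj_zero_sub_proj_eventually)
open Literature.MathematicalPhysics.QuantumFieldTheory.Balaban1983to89.B12Sec2to5 (l1)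
open Literature.MathematicalPhysics.QuantumFieldTheory.Balaban1983to89.Beta.RemainderChain
open Literature.MathematicalPhysics.QuantumFieldTheory.Balaban1983to89.Beta.RemainderChainKP (h118_linear_of_KP)
open Literature.MathematicalPhysics.QuantumFieldTheory.Balaban1983to89.Beta.RemainderChainLattice
  (CondsL SignsL remCoeffL polConstL deltaL deltaL_pos eps1_mul_remCoeffL)
open Literature.MathematicalPhysics.QuantumFieldTheory.Balaban1983to89.Beta.RemainderLimitTorus
open Literature.MathematicalPhysics.QuantumFieldTheory.Balaban1983to89.Beta.DriftRemainder
  (betaPartialSumsLowerH_of_telescope_remainderConst endpointExistence_of_telescope_remainderConst)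
open Metric Filter Topology

noncomputable section

variable {d : ℕ}

/-! ## §1 The torus leaf list with termwise locality — holomorphic currency -/

/-- **`RemainderLimitTorus.PolLeavesTLoc` WITH `han` REPLACED BY `hdiff`**: the torus leaf list with termwise locality
((F1)+(F2) already traded for `hloc`), the (4.4)-leaf read as complex FRÉCHET differentiability of
𝐀 ↦ 𝐄^{(k+1)}(X̄, exp iξ𝐀) on the open α₂-ball (every other field verbatim).  A HYPOTHESIS structure.
[cite: Balaban1987RG1, (4.4) p.281, (1.21) p.264 and (4.35) p.290; Balaban1988RG2Cluster, (2.38) p.20] -/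
structure PolLeavesTLocH (d M : ℕ) [NeZero M] (a : LDom d → Pt d → ℝ) (c : B13.Consts) (ℓ α₂ B₃ : ℝ) where
  N : ℕ → ℕ
  [hN : ∀ n, NeZero (N n)]
  hNlim : Tendsto N atTop atTop
  W : (n : ℕ) → TorusStep d (N n)
  hsp : ∀ n, SpRestr (W n).toStepData (W n).geom
  hrep : ∀ n, Repr213 (W n).toStepData (W n).geom
  h238 : ∀ n, B13.Bound238With (W n).toStepData c ℓ
  Wn : ℕ → Type
  [instW : ∀ n, NormedAddCommGroup (Wn n)]
  [instWs : ∀ n, NormedSpace ℂ (Wn n)]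
  EXn : (n : ℕ) → TDom d (N n) → Wn n → ℂ
  emb : (n : ℕ) → TDom d (N n) → Wn n → (W n).Φ
  hemb : ∀ n X, ∀ v ∈ ball (0 : Wn n) α₂, emb n X v ∈ (W n).sp2 X
  hcomp : ∀ n X v, EXn n X v = (W n).Ek1 X (emb n X v)
  hn : (n : ℕ) → TDom d (N n) → TPt d (N n * M) → Wn n
  E2n : (n : ℕ) → TDom d (N n) → TPt d (N n * M) → TPt d (N n * M) → ℝ
  hdiff : ∀ n X, DifferentiableOn ℂ (EXn n X) (ball 0 α₂)
  hrepr : ∀ n X x y, E2n n X x y = (mixedDeriv (EXn n X) (hn n X x) (hn n X y)).re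
  hh : ∀ n X x, ‖hn n X x‖ ≤ B₃ * Real.exp (-c.δ₀ * distCT (N n) M x (nearT (M := M) x X))
  hloc : ∀ (Y : LDom d) (z : Pt d),
    Tendsto (fun n => E2n n (tproj (N n) Y) (proj (N n * M) 0) (proj (N n * M) z)) atTop (𝓝 (a Y z))

/-- The carried `NeZero (N n)` witnesses. [folklore] -/
instance PolLeavesTLocH.instNeZeroN {d M : ℕ} [NeZero M] {a : LDom d → Pt d → ℝ} {c : B13.Consts} {ℓ α₂ B₃ : ℝ}
    (Lv : PolLeavesTLocH d M a c ℓ α₂ B₃) (n : ℕ) : NeZero (Lv.N n) := Lv.hN n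

/-- The carried normed-group structures of the test-vector spaces. [folklore] -/
instance PolLeavesTLocH.instNormedAddCommGroupWn {d M : ℕ} [NeZero M] {a : LDom d → Pt d → ℝ} {c : B13.Consts}
    {ℓ α₂ B₃ : ℝ} (Lv : PolLeavesTLocH d M a c ℓ α₂ B₃) (n : ℕ) : NormedAddCommGroup (Lv.Wn n) := Lv.instW n

/-- The carried ℂ-normed-space structures of the test-vector spaces. [folklore] -/
instance PolLeavesTLocH.instNormedSpaceWn {d M : ℕ} [NeZero M] {a : LDom d → Pt d → ℝ} {c : B13.Consts}
    {ℓ α₂ B₃ : ℝ} (Lv : PolLeavesTLocH d M a c ℓ α₂ B₃) (n : ℕ) : NormedSpace ℂ (Lv.Wn n) := Lv.instWs n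

section Leaves

variable {M : ℕ} [NeZero M] {a : LDom d → Pt d → ℝ} {c : B13.Consts} {ℓ α₂ B₃ : ℝ}

/-- **The (I.1.18)-leaf DERIVED on torus n** (`RemainderChainKP.h118_linear_of_KP` at the constructed torus geometry; no
analyticity used): `‖E^{(k+1)}(X̄, emb v)‖ ≤ A_rem e^{−κ·d_{k+1}(X̄)}` on the α₂-ball.
[cite: Balaban1988RG2Cluster, (2.38) p.20 and (2.41) p.21] -/
theorem PolLeavesTLocH.h118 (Lv : PolLeavesTLocH d M a c ℓ α₂ B₃) (hC : CondsL d c ℓ) (h22 : c.R22gen ℓ) (hA : 0 ≤ c.C3act * c.ε₁) (n : ℕ) :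
    ∀ X, ∀ v ∈ ball (0 : Lv.Wn n) α₂, ‖Lv.EXn n X v‖ ≤ remActivity c * Real.exp (-c.κ * torusTreeLen X.1) :=
  h118_linear_of_KP (Lv.W n).toStepData c ℓ (Lv.W n).geom (Lv.hsp n) (Lv.hrep n) (Lv.h238 n) h22 hA
    hC.kappa_pos.le hC.large hC.small hC.A₂ (Lv.emb n) (Lv.EXn n) (Lv.hemb n) (Lv.hcomp n)

/-- **The two-sided kernel bound on torus n — Cauchy estimate in holomorphic currency**
(`B12Decay510.kernelBound_of_repr435` on (4.35), `B12Decay510Holo.qBound_of_differentiableOn` from the derived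
(1.18)-leaf, the p. 282 decay): ∣𝐄^{(2)}_n(X̄, x, y)∣ ≤ 4A_rem α₂⁻² B₃² e^{−κ d_j(X̄)} e^{−δ₀ dist(x, X̄)} e^{−δ₀ dist(y, X̄)}.
[cite: Balaban1987RG1, (4.35) p.290 and (4.5) p.282] -/
theorem PolLeavesTLocH.kernelBound (Lv : PolLeavesTLocH d M a c ℓ α₂ B₃) (hC : CondsL d c ℓ) (h22 : c.R22gen ℓ) (hs : SignsL c α₂ B₃) (n : ℕ) :
    KernelBound (geomT d (Lv.N n) M) (Lv.E2n n) (4 * remActivity c / α₂ ^ 2 * B₃ ^ 2) c.κ c.δ₀ :=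
  kernelBound_of_repr435 (S := tsys d (Lv.N n)) (geomT d (Lv.N n) M) (V := fun _ => Lv.Wn n)
    (fun X u v => (mixedDeriv (Lv.EXn n X) u v).re) (Lv.hn n) (Lv.E2n n)
    (div_nonneg (mul_nonneg (by norm_num) (hC.remActivity_nonneg hs.A)) (sq_nonneg _)) hs.B₃_nonneg (Lv.hrepr n)
    (qBound_of_differentiableOn (S := tsys d (Lv.N n)) (Lv.EXn n) hs.α₂_pos (Lv.hdiff n) (Lv.h118 hC h22 hs.A n))
    (Lv.hh n)

/-- One distance factor dropped: ∣𝐄^{(2)}_n(X̄, x, y)∣ ≤ 4A_rem α₂⁻² B₃² e^{−κ d_j(X̄)} e^{−δ₀ dist(x, X̄)} (the (4.35)/(4.5)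
kernel bound, one decay factor discarded). [cite: Balaban1987RG1, (4.35) p.290 and (4.5) p.282] -/
theorem PolLeavesTLocH.abs_term_le (Lv : PolLeavesTLocH d M a c ℓ α₂ B₃) (hC : CondsL d c ℓ) (h22 : c.R22gen ℓ) (hs : SignsL c α₂ B₃) (n : ℕ)
    (X : TDom d (Lv.N n)) (x y : TPt d (Lv.N n * M)) :
    |Lv.E2n n X x y| ≤ 4 * remActivity c / α₂ ^ 2 * B₃ ^ 2 * Real.exp (-c.κ * torusTreeLen X.1) *
      Real.exp (-c.δ₀ * distCT (Lv.N n) M x (nearT (M := M) x X)) := by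
  have h := Lv.kernelBound hC h22 hs n X x y
  simp only [geomT_distD, tsys_dj] at h
  have hD := distCT_nonneg (N := Lv.N n) (M := M) y (nearT (M := M) y X)
  have hδ := hs.δ₀_pos
  have h1 : Real.exp (-c.δ₀ * distCT (Lv.N n) M y (nearT (M := M) y X)) ≤ 1 :=
    Real.exp_le_one_iff.2 (by nlinarith)
  have hA : 0 ≤ 4 * remActivity c / α₂ ^ 2 := div_nonneg (by linarith [hC.remActivity_nonneg hs.A]) (sq_nonneg _)
  have h0 : 0 ≤ 4 * remActivity c / α₂ ^ 2 * B₃ ^ 2 * Real.exp (-c.κ * torusTreeLen X.1) *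
      Real.exp (-c.δ₀ * distCT (Lv.N n) M x (nearT (M := M) x X)) := by positivity
  calc |Lv.E2n n X x y| ≤ _ := h
    _ ≤ 4 * remActivity c / α₂ ^ 2 * B₃ ^ 2 * Real.exp (-c.κ * torusTreeLen X.1) *
      Real.exp (-c.δ₀ * distCT (Lv.N n) M x (nearT (M := M) x X)) * 1 := mul_le_mul_of_nonneg_left h1 h0
    _ = _ := mul_one _

/-- The radius of the box at step n: R_n := ⌊(N_n − 3)/2⌋. [folklore] -/
def PolLeavesTLocH.rad (Lv : PolLeavesTLocH d M a c ℓ α₂ B₃) (n : ℕ) : ℕ := (Lv.N n - 3) / 2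

/-- 2R_n + 3 ≤ N_n once N_n ≥ 3. [folklore] -/
private theorem PolLeavesTLocH.rad_spec (Lv : PolLeavesTLocH d M a c ℓ α₂ B₃) {n : ℕ} (hn : 3 ≤ Lv.N n) : 2 * Lv.rad n + 3 ≤ Lv.N n := by
  unfold PolLeavesTLocH.rad
  omega

/-- **Domination of the non-wrapping terms**: for X̄ in the box of radius R_n, ∣𝐄^{(2)}_n(X̄, 0, y)∣ ≤ g(lift of X̄) —
the termwise majorant for the T ↗ ℤ^d limit (1.21)/(5.1). [cite: Balaban1987RG1, (1.21) p.264 and (5.1) p.292] -/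
theorem PolLeavesTLocH.abs_term_le_major (Lv : PolLeavesTLocH d M a c ℓ α₂ B₃) (hC : CondsL d c ℓ) (h22 : c.R22gen ℓ) (hs : SignsL c α₂ B₃) {n : ℕ}
    (hn : 3 ≤ Lv.N n) {X : TDom d (Lv.N n)} (hX : Small (Lv.rad n) X.1) (y : TPt d (Lv.N n * M)) :
    |Lv.E2n n X 0 y| ≤ major d M c α₂ B₃ (liftDom X) := by
  have hN := Lv.rad_spec hn
  have h := Lv.abs_term_le hC h22 hs n X 0 y
  have hA : 0 ≤ 4 * remActivity c / α₂ ^ 2 := div_nonneg (by linarith [hC.remActivity_nonneg hs.A]) (sq_nonneg _)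
  have hC0 : 0 ≤ 4 * remActivity c / α₂ ^ 2 * B₃ ^ 2 := mul_nonneg hA (sq_nonneg _)
  have hv : Real.exp (-c.κ * torusTreeLen X.1) ≤
      Real.exp (kappa₀ (4 * 2 ^ d) (2 * d)) * Real.exp (-a₀ (2 * d) * (X.1.card : ℝ)) := by
    have := exp_tree_le_exp_vol (tcubeSys d (Lv.N n)) (tvolumeLeaf d (Lv.N n)) (κ := c.κ) (Δ := 2 * d)
      (by linarith [hC.tree, hC.kappa_pos]) X
    rwa [tsys_dj, tcubeSys_vol] at this
  have hD : Real.exp (-c.δ₀ * distCT (Lv.N n) M 0 (nearT (M := M) 0 X)) ≤ Real.exp (-c.δ₀ * dL M (liftDom X)) :=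
    Real.exp_le_exp.2 (by have := dL_liftDom_le (M := M) hN hX; nlinarith [hs.δ₀_pos])
  calc |Lv.E2n n X 0 y| ≤ _ := h
    _ ≤ 4 * remActivity c / α₂ ^ 2 * B₃ ^ 2 *
          (Real.exp (kappa₀ (4 * 2 ^ d) (2 * d)) * Real.exp (-a₀ (2 * d) * (X.1.card : ℝ))) *
          Real.exp (-c.δ₀ * dL M (liftDom X)) :=
        mul_le_mul (mul_le_mul_of_nonneg_left hv hC0) hD (Real.exp_pos _).le (mul_nonneg hC0 (by positivity))
    _ = major d M c α₂ B₃ (liftDom X) := by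
        rw [major, card_liftDom hN hX]
        ring

open Classical in
/-- The non-wrapping ("good") domains at step n. [folklore] -/
def PolLeavesTLocH.good (Lv : PolLeavesTLocH d M a c ℓ α₂ B₃) (n : ℕ) : Finset (TDom d (Lv.N n)) :=
  Finset.univ.filter fun X => 3 ≤ Lv.N n ∧ Small (Lv.rad n) X.1

open Classical in
/-- The remaining ("bad", wrapping or far) domains at step n. [folklore] -/
def PolLeavesTLocH.bad (Lv : PolLeavesTLocH d M a c ℓ α₂ B₃) (n : ℕ) : Finset (TDom d (Lv.N n)) :=
  Finset.univ.filter fun X => ¬ (3 ≤ Lv.N n ∧ Small (Lv.rad n) X.1)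

/-- Membership in the good part, unfolded. [folklore] -/
private theorem PolLeavesTLocH.mem_good (Lv : PolLeavesTLocH d M a c ℓ α₂ B₃) {n : ℕ} {X : TDom d (Lv.N n)} :
    X ∈ Lv.good n ↔ 3 ≤ Lv.N n ∧ Small (Lv.rad n) X.1 := by
  classical
  simp [PolLeavesTLocH.good]

/-- Membership in the bad part, unfolded. [folklore] -/
private theorem PolLeavesTLocH.mem_bad (Lv : PolLeavesTLocH d M a c ℓ α₂ B₃) {n : ℕ} {X : TDom d (Lv.N n)} :
    X ∈ Lv.bad n ↔ ¬ (3 ≤ Lv.N n ∧ Small (Lv.rad n) X.1) := by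
  classical
  simp [PolLeavesTLocH.bad]

/-- **The wrapping mass at step n**: Σ_{X̄ bad} ∣𝐄^{(2)}_n(X̄, 0, y)∣ ≤ 4A_rem α₂⁻² B₃² K₀ K₁(δ₀/2) · e^{−η(R_n − 2)},
η = min{κ/2, δ₀/2} — the volume-uniformity step of the T ↗ ℤ^d limit (1.21)/(5.1).
[cite: Balaban1987RG1, (1.21) p.264 and (5.1) p.292] -/
theorem PolLeavesTLocH.bad_mass_le (Lv : PolLeavesTLocH d M a c ℓ α₂ B₃) (hC : CondsL d c ℓ) (h22 : c.R22gen ℓ) (hs : SignsL c α₂ B₃) {n : ℕ}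
    (hn : 3 ≤ Lv.N n) (y : TPt d (Lv.N n * M)) :
    ∑ X ∈ Lv.bad n, |Lv.E2n n X 0 y| ≤ 4 * remActivity c / α₂ ^ 2 * B₃ ^ 2 * K₀ (4 * 2 ^ d) (2 * d) *
      K₁ d (c.δ₀ / 2) * Real.exp (-(min (c.κ / 2) (c.δ₀ / 2) * ((Lv.rad n : ℝ) - 2))) := by
  have hκ := hC.kappa_pos
  have hδ := hs.δ₀_pos
  have hη : 0 ≤ min (c.κ / 2) (c.δ₀ / 2) := le_min (by linarith) (by linarith)
  have hA : 0 ≤ 4 * remActivity c / α₂ ^ 2 := div_nonneg (by linarith [hC.remActivity_nonneg hs.A]) (sq_nonneg _)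
  have hCE : 0 ≤ 4 * remActivity c / α₂ ^ 2 * B₃ ^ 2 := mul_nonneg hA (sq_nonneg _)
  have hterm : ∀ X ∈ Lv.bad n, |Lv.E2n n X 0 y| ≤
      4 * remActivity c / α₂ ^ 2 * B₃ ^ 2 * Real.exp (-(min (c.κ / 2) (c.δ₀ / 2) * ((Lv.rad n : ℝ) - 2))) *
        (Real.exp (-(c.κ / 2) * torusTreeLen X.1) *
          Real.exp (-(c.δ₀ / 2) * distCT (Lv.N n) M 0 (nearT (M := M) 0 X))) := by
    intro X hX
    have hX' : ¬ Small (Lv.rad n) X.1 := fun h => (Lv.mem_bad.1 hX) ⟨hn, h⟩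
    have hgeo := sub_lt_dist_add_treeLen (M := M) X hX'
    have h := Lv.abs_term_le hC h22 hs n X 0 y
    have hd := torusTreeLen_nonneg X.1
    have hD := distCT_nonneg (N := Lv.N n) (M := M) 0 (nearT (M := M) 0 X)
    have h1 : min (c.κ / 2) (c.δ₀ / 2) * torusTreeLen X.1 ≤ c.κ / 2 * torusTreeLen X.1 :=
      mul_le_mul_of_nonneg_right (min_le_left _ _) hd
    have h2 : min (c.κ / 2) (c.δ₀ / 2) * distCT (Lv.N n) M 0 (nearT (M := M) 0 X) ≤
        c.δ₀ / 2 * distCT (Lv.N n) M 0 (nearT (M := M) 0 X) := mul_le_mul_of_nonneg_right (min_le_right _ _) hD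
    have h3 : min (c.κ / 2) (c.δ₀ / 2) * ((Lv.rad n : ℝ) - 2) ≤
        min (c.κ / 2) (c.δ₀ / 2) * (distCT (Lv.N n) M 0 (nearT (M := M) 0 X) + torusTreeLen X.1) :=
      mul_le_mul_of_nonneg_left hgeo.le hη
    have key : -c.κ * torusTreeLen X.1 + -c.δ₀ * distCT (Lv.N n) M 0 (nearT (M := M) 0 X) ≤
        -(min (c.κ / 2) (c.δ₀ / 2) * ((Lv.rad n : ℝ) - 2)) +
          (-(c.κ / 2) * torusTreeLen X.1 + -(c.δ₀ / 2) * distCT (Lv.N n) M 0 (nearT (M := M) 0 X)) := by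
      nlinarith
    calc |Lv.E2n n X 0 y| ≤ _ := h
      _ = 4 * remActivity c / α₂ ^ 2 * B₃ ^ 2 *
            Real.exp (-c.κ * torusTreeLen X.1 + -c.δ₀ * distCT (Lv.N n) M 0 (nearT (M := M) 0 X)) := by
          rw [Real.exp_add]; ring
      _ ≤ 4 * remActivity c / α₂ ^ 2 * B₃ ^ 2 *
            Real.exp (-(min (c.κ / 2) (c.δ₀ / 2) * ((Lv.rad n : ℝ) - 2)) +
              (-(c.κ / 2) * torusTreeLen X.1 + -(c.δ₀ / 2) * distCT (Lv.N n) M 0 (nearT (M := M) 0 X))) :=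
          mul_le_mul_of_nonneg_left (Real.exp_le_exp.2 key) hCE
      _ = _ := by rw [Real.exp_add, Real.exp_add]; ring
  have hsum := weight_sum_le (geomT d (Lv.N n) M) (K₀_pos _ _).le (cubeSumLeafT d (Lv.N n) M (half_pos hδ))
    (treeLeafT d (Lv.N n) hC.tree) (0 : TPt d (Lv.N n * M))
  have hpick : ∀ X : TDom d (Lv.N n), (geomT d (Lv.N n) M).distC 0 ((geomT d (Lv.N n) M).pick 0 X) =
      distCT (Lv.N n) M 0 (nearT (M := M) 0 X) := fun X => rfl
  simp only [hpick, tsys_dj] at hsum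
  have hw0 : ∀ X : TDom d (Lv.N n), 0 ≤
      4 * remActivity c / α₂ ^ 2 * B₃ ^ 2 * Real.exp (-(min (c.κ / 2) (c.δ₀ / 2) * ((Lv.rad n : ℝ) - 2))) *
        (Real.exp (-(c.κ / 2) * torusTreeLen X.1) *
          Real.exp (-(c.δ₀ / 2) * distCT (Lv.N n) M 0 (nearT (M := M) 0 X))) := fun X => by positivity
  calc ∑ X ∈ Lv.bad n, |Lv.E2n n X 0 y|
      ≤ ∑ X ∈ Lv.bad n, 4 * remActivity c / α₂ ^ 2 * B₃ ^ 2 *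
          Real.exp (-(min (c.κ / 2) (c.δ₀ / 2) * ((Lv.rad n : ℝ) - 2))) *
          (Real.exp (-(c.κ / 2) * torusTreeLen X.1) *
            Real.exp (-(c.δ₀ / 2) * distCT (Lv.N n) M 0 (nearT (M := M) 0 X))) := Finset.sum_le_sum hterm
    _ ≤ ∑ X, 4 * remActivity c / α₂ ^ 2 * B₃ ^ 2 *
          Real.exp (-(min (c.κ / 2) (c.δ₀ / 2) * ((Lv.rad n : ℝ) - 2))) *
          (Real.exp (-(c.κ / 2) * torusTreeLen X.1) *
            Real.exp (-(c.δ₀ / 2) * distCT (Lv.N n) M 0 (nearT (M := M) 0 X))) :=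
        Finset.sum_le_sum_of_subset_of_nonneg (Finset.subset_univ _) fun X _ _ => hw0 X
    _ = 4 * remActivity c / α₂ ^ 2 * B₃ ^ 2 * Real.exp (-(min (c.κ / 2) (c.δ₀ / 2) * ((Lv.rad n : ℝ) - 2))) *
          ∑ X : TDom d (Lv.N n), Real.exp (-(c.κ / 2) * torusTreeLen X.1) *
            Real.exp (-(c.δ₀ / 2) * distCT (Lv.N n) M 0 (nearT (M := M) 0 X)) := by rw [Finset.mul_sum]
    _ ≤ 4 * remActivity c / α₂ ^ 2 * B₃ ^ 2 * Real.exp (-(min (c.κ / 2) (c.δ₀ / 2) * ((Lv.rad n : ℝ) - 2))) *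
          (K₀ (4 * 2 ^ d) (2 * d) * K₁ d (c.δ₀ / 2)) :=
        mul_le_mul_of_nonneg_left hsum (by positivity)
    _ = _ := by ring

/-- **The wrapping mass tends to zero** (R_n → ∞ with N_n; η > 0) — step of the T ↗ ℤ^d limit (1.21)/(5.1).
[cite: Balaban1987RG1, (1.21) p.264 and (5.1) p.292] -/
theorem PolLeavesTLocH.tendsto_bad_mass (Lv : PolLeavesTLocH d M a c ℓ α₂ B₃) (hC : CondsL d c ℓ) (h22 : c.R22gen ℓ) (hs : SignsL c α₂ B₃) (z : Pt d) :
    Tendsto (fun n => ∑ X ∈ Lv.bad n, |Lv.E2n n X (proj (Lv.N n * M) 0) (proj (Lv.N n * M) z)|) atTop (𝓝 0) := by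
  have hη : 0 < min (c.κ / 2) (c.δ₀ / 2) := lt_min (by linarith [hC.kappa_pos]) (by linarith [hs.δ₀_pos])
  have hN3 : ∀ᶠ n in atTop, 3 ≤ Lv.N n := (tendsto_atTop.1 Lv.hNlim) 3
  have hrad : Tendsto (fun n => ((Lv.rad n : ℕ) : ℝ)) atTop atTop := by
    refine tendsto_natCast_atTop_atTop.comp ?_
    rw [tendsto_atTop_atTop]
    intro b
    obtain ⟨n₀, hn₀⟩ := (tendsto_atTop_atTop.1 Lv.hNlim) (2 * b + 3)
    refine ⟨n₀, fun n hn => ?_⟩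
    have := hn₀ n hn
    unfold PolLeavesTLocH.rad
    omega
  have h0 : Tendsto (fun n => (Lv.rad n : ℝ) - 2) atTop atTop := by
    simpa [sub_eq_add_neg] using tendsto_atTop_add_const_right atTop (-2 : ℝ) hrad
  have h1 : Tendsto (fun n => min (c.κ / 2) (c.δ₀ / 2) * ((Lv.rad n : ℝ) - 2)) atTop atTop :=
    Tendsto.const_mul_atTop hη h0
  have h2 := (Real.tendsto_exp_neg_atTop_nhds_zero.comp h1).const_mul
    (4 * remActivity c / α₂ ^ 2 * B₃ ^ 2 * K₀ (4 * 2 ^ d) (2 * d) * K₁ d (c.δ₀ / 2))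
  rw [mul_zero] at h2
  refine squeeze_zero' (Eventually.of_forall fun n => Finset.sum_nonneg fun X _ => abs_nonneg _) ?_ h2
  filter_upwards [hN3] with n hn
  rw [proj_zero]
  exact Lv.bad_mass_le hC h22 hs hn (proj (Lv.N n * M) z)

/-- **Every lattice domain is eventually good**: for n large the reduction of Y lies in the box of radius R_n and Y is its
lift — step of the T ↗ ℤ^d limit (1.21)/(5.1). [cite: Balaban1987RG1, (1.21) p.264 and (5.1) p.292] -/
theorem PolLeavesTLocH.eventually_good (Lv : PolLeavesTLocH d M a c ℓ α₂ B₃) (Y : LDom d) :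
    ∀ᶠ n in atTop, tproj (Lv.N n) Y ∈ Lv.good n ∧ liftDom (tproj (Lv.N n) Y) = Y := by
  classical
  set RY : ℕ := Y.1.sup fun y => Finset.univ.sup fun i => (y i).natAbs with hRYdef
  have hRY : ∀ y ∈ Y.1, ∀ i, |y i| ≤ (RY : ℤ) := by
    intro y hy i
    have h1 : (y i).natAbs ≤ Finset.univ.sup (fun i => (y i).natAbs) :=
      Finset.le_sup (f := fun i => (y i).natAbs) (Finset.mem_univ i)
    have h2 : Finset.univ.sup (fun i => (y i).natAbs) ≤ RY :=
      Finset.le_sup (f := fun y : Pt d => Finset.univ.sup fun i => (y i).natAbs) hy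
    rw [← Int.natCast_natAbs]
    exact_mod_cast h1.trans h2
  have h3 : ∀ᶠ n in atTop, 2 * RY + 3 ≤ Lv.N n := (tendsto_atTop.1 Lv.hNlim) _
  filter_upwards [h3] with n hn
  have hn3 : 3 ≤ Lv.N n := by omega
  have hR : RY ≤ Lv.rad n := by
    unfold PolLeavesTLocH.rad
    omega
  have hbox : InBox (Lv.rad n) Y := fun y hy i => (hRY y hy i).trans (by exact_mod_cast hR)
  have hN := Lv.rad_spec hn3
  exact ⟨Lv.mem_good.2 ⟨hn3, small_tproj hN hbox⟩, liftDom_tproj hN hbox⟩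

/-- **(5.1) PROVED in holomorphic currency — THE LIMIT T₁ ↗ ℤ^d OF THE POLARIZATION KERNELS EXISTS** under termwise
locality: Σ_{X̄ ∈ 𝐃(T_n)} 𝐄^{(2)}_n(X̄, 0, z) → Π(z) := Σ'_{Y ∈ 𝐃(ℤ^d)} a_Y(z), absolutely convergent and dominated termwise by
`major` (dominated convergence `RemainderLimitTorus.tendsto_sum_of_dominated_pullback`).
[cite: Balaban1987RG1, (1.21) p.264 and (5.1) p.292] -/
theorem PolLeavesTLocH.tendsto_sum (Lv : PolLeavesTLocH d M a c ℓ α₂ B₃) (hC : CondsL d c ℓ) (h22 : c.R22gen ℓ) (hs : SignsL c α₂ B₃) (z : Pt d) :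
    Summable (fun Y => a Y z) ∧ (∀ Y, |a Y z| ≤ major d M c α₂ B₃ Y) ∧
      Tendsto (fun n => ∑ X : TDom d (Lv.N n), Lv.E2n n X (proj (Lv.N n * M) 0) (proj (Lv.N n * M) z)) atTop
        (𝓝 (limKernel a z)) := by
  have hA := hC.remActivity_nonneg hs.A
  refine tendsto_sum_of_dominated_pullback (J := LDom d) (T := fun n => TDom d (Lv.N n))
    (fun n X => Lv.E2n n X (proj (Lv.N n * M) 0) (proj (Lv.N n * M) z)) Lv.good Lv.bad (fun n X => liftDom X)
    (fun n Y => tproj (Lv.N n) Y) (fun Y => a Y z) (major d M c α₂ B₃) (fun n X hX => ?_) (fun n => ?_)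
    Lv.eventually_good (fun Y => Lv.hloc Y z) (fun n X hX => ?_) (major_nonneg hA) (summable_major hs.δ₀_pos)
    (Lv.tendsto_bad_mass hC h22 hs z)
  · exact Lv.mem_bad.2 fun h => hX (Lv.mem_good.2 h)
  · intro X hX X' hX' h
    have h1 := Lv.mem_good.1 hX
    have h2 := Lv.mem_good.1 hX'
    exact liftDom_injOn (Lv.rad_spec h1.1) h1.2 h2.2 h
  · obtain ⟨hn, hsm⟩ := Lv.mem_good.1 hX
    rw [proj_zero]
    exact Lv.abs_term_le_major hC h22 hs hn hsm _

/-- The limit kernel (5.1) is an absolutely convergent sum, termwise dominated by the majorant.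
[cite: Balaban1987RG1, (5.1) p.292] -/
theorem PolLeavesTLocH.summable (Lv : PolLeavesTLocH d M a c ℓ α₂ B₃) (hC : CondsL d c ℓ) (h22 : c.R22gen ℓ) (hs : SignsL c α₂ B₃) (z : Pt d) :
    Summable (fun Y => a Y z) :=
  (Lv.tendsto_sum hC h22 hs z).1

/-- **(L2)–(L3) on the periodic carrier, holomorphic currency**: the leaves give the (5.10)-decay of the DEFINED limit
kernel `|Π(x)| ≤ A_rem · K_Π,L · e^{−δ₁|x|₁}`, `δ₁ = ½ min{δ₀, κ(Md)⁻¹}`, with the SAME constants `polConstL`, `deltaL`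
as `RemainderChainTorus.PolLeavesT.decay510` — via `B12Decay510Holo.decay510_of_differentiable_leaves` on the torus
leaves `geomLeafT`, `cubeSumLeafT`, `treeLeafT`, `pl1_proj_zero_sub_proj_eventually` and the (5.1)-limit of
`tendsto_sum`. [cite: Balaban1987RG1, (5.10) p.293] -/
theorem PolLeavesTLocH.decay510 (Lv : PolLeavesTLocH d M a c ℓ α₂ B₃) (hC : CondsL d c ℓ) (h22 : c.R22gen ℓ) (hs : SignsL c α₂ B₃) (hd : 0 < d) :
    B12Sec2to5.Decay510 (limKernel a) (remActivity c * polConstL d M c α₂ B₃) (deltaL d M c) := by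
  have hM : (0 : ℝ) < (M : ℝ) * d := mul_pos (Nat.cast_pos.2 (Nat.pos_of_neZero M)) (Nat.cast_pos.2 hd)
  have h := decay510_of_differentiable_leaves (fun n => tsys d (Lv.N n))
    (fun n => (tcubeSys d (Lv.N n)).toCubeCover) (fun n => TPt d (Lv.N n * M)) (fun n => geomT d (Lv.N n) M)
    (fun _ x y => pl1 (x - y)) Lv.Wn Lv.EXn Lv.hn Lv.E2n (fun n z => proj (Lv.N n * M) z) (limKernel a)
    (c₁ := 3) (K₀ := K₀ (4 * 2 ^ d) (2 * d)) (K₁ := K₁ d (c.δ₀ / 2))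
    hs.α₂_pos (hC.remActivity_nonneg hs.A) hs.B₃_nonneg (K₀_pos _ _).le hs.δ₀_pos.le hC.kappa_pos.le hM Lv.hdiff
    (fun n => Lv.h118 hC h22 hs.A n) Lv.hrepr Lv.hh (fun n => geomLeafT d (Lv.N n) M)
    (fun n => cubeSumLeafT d (Lv.N n) M (half_pos hs.δ₀_pos)) (fun n => treeLeafT d (Lv.N n) hC.tree)
    (pl1_proj_zero_sub_proj_eventually Lv.N Lv.hNlim) (fun z => (Lv.tendsto_sum hC h22 hs z).2.2)
  rw [decayConst_eq] at h
  exact h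

end Leaves

end

end Literature.MathematicalPhysics.QuantumFieldTheory.Balaban1983to89.Beta.RemainderLimitTorusHolo
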